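import Summits.AnomalousDissipation.AnomalousDissipation.Theses.TwoAndHalfD
import Literature.Analysis.FluidPDE.PassiveScalarClassicalEnergy
import Literature.Analysis.FluidPDE.PassiveScalarClassicalWeak
import Summits.AnomalousDissipation.AnomalousDissipation.Theorems.TwoAndHalfDScalarAnomalySteadySourceFormalColdStartVarianceToolkit

/-!
# F1 `stub_coherenceOfEnergy`: the kinematic coherence gate of a passive-scalar release

Stub F1 of the line `Sketch` (duhamel-release) for the crux
`Summit.AnomalousDissipation.AnomalousDissipation.Theses.TwoAndHalfD.TwohalfdThesis`
(stmt-AnomalousDissipation-0206); the statement is registered verbatim on the item.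

CONTENT. Let `0 ≤ κ ≤ 1`, let `h` be a smooth pattern on `T²`, and let `φ` be a classical solution
of the UNFORCED advection–diffusion equation `∂ₜφ + u·∇φ = κΔφ`, `div u = 0`, on `[s, ∞) × T²`
released from `φ(s) = h`, the drift having pointwise-in-time kinetic energy `∫ ‖u(t)‖² ≤ E`
(`t ≥ s`). Then the datum correlation `C(t) := ∫ h φ(t)` cannot leave its initial value
`C(s) = ‖h‖²_{L²}` faster than linearly at the advective rate:

  `‖h‖² - (‖Δh‖_{L²} + ‖∇h‖_{L^∞} √E) ‖h‖_{L²} (t - s) ≤ ∫ h φ(t)`     (`t ≥ s`).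

PROOF. `C` is differentiable within `[s, ∞)` with
`C'(t) = ∫ h ∂ₜφ = κ ∫ h Δφ - ∫ h ⟪u, ∇φ⟫ = κ ∫ (Δh) φ + ∫ ⟪u, ∇h⟫ φ`
(differentiation under `∫_{T²}`, `Torus.IsSmoothSpaceTimeOn.hasDerivWithinAt_integral`; Green's
second identity `Torus.integral_mul_laplacian_comm_holds`; the transport identity
`Torus.integral_mul_inner_gradient_add_eq_zero` for `div u = 0`) —
`hasDerivWithinAt_integral_mul_release`. Cauchy–Schwarz and the `L²` contraction
`‖φ(t)‖ ≤ ‖φ(s)‖ = ‖h‖` (`IsClassicalScalarTransportOn.antitoneOn_scalarL2Sq`, `κ ≥ 0`) give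
`κ ∫ (Δh) φ ≥ -κ‖Δh‖‖φ(t)‖ ≥ -‖Δh‖‖h‖` (`κ ≤ 1`) and
`∫ ⟪u, ∇h⟫ φ ≥ -‖∇h‖_∞ ∫ ‖u‖|φ| ≥ -‖∇h‖_∞ √E ‖h‖`, so `C' ≥ -K` with `K` the displayed rate;
hence `t ↦ C(t) + K t` is non-decreasing on the convex set `[s, ∞)`
(Mathlib `monotoneOn_of_hasDerivWithinAt_nonneg`) and `C(t) ≥ C(s) - K (t - s)`.
Supports stmt-AnomalousDissipation-0206. [folklore: DEIJ 2022, §1 (1.1)–(1.3); Evans 2010,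
App. C.2 Thms. 2–3]
-/

noncomputable section

-- the summit path `AnomalousDissipation/AnomalousDissipation` duplicates a namespace component
set_option linter.dupNamespace false

namespace Summit.AnomalousDissipation.AnomalousDissipation.Theorems.TwohalfdThesis

open MeasureTheory Set Filter Topology
open scoped ENNReal NNReal InnerProductSpace
open Literature.Analysis.FunctionSpaces Literature.Analysis.FluidPDE

variable {d : Type*} [Fintype d] [DecidableEq d]

/-! ## The derivative of the datum correlation -/

/-- **Derivative of the datum correlation.** For a classical solution `φ` of
`∂ₜφ + u·∇φ = κΔφ`, `div u = 0`, on `S × T^d` (`S` convex, of unique differentiability) and a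
smooth time-independent `h`, the pairing `τ ↦ ∫ h φ(τ)` has one-sided derivative
`κ ∫ (Δh) φ(t) + ∫ ⟪u(t), ∇h⟫ φ(t)` within `S` at every `t ∈ S`: differentiate under the
integral, insert the equation, and integrate by parts twice on the torus (Green's second
identity; the transport identity `∫ h ⟪u, ∇φ⟫ + ∫ ⟪u, ∇h⟫ φ = 0`). [folklore] -/
theorem hasDerivWithinAt_integral_mul_release {S : Set ℝ} {κ : ℝ}
    {u : ℝ → UnitAddTorus d → EuclideanSpace ℝ d} {h : UnitAddTorus d → ℝ}
    {φ : ℝ → UnitAddTorus d → ℝ} (hS : Convex ℝ S) (hU : UniqueDiffOn ℝ S)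
    (hh : Torus.IsSmooth h) (hφ : Torus.IsClassicalScalarTransportOn S κ u φ) {t : ℝ}
    (ht : t ∈ S) :
    HasDerivWithinAt (fun τ => ∫ x, h x * φ τ x)
      (κ * (∫ x, Torus.laplacian h x * φ t x) +
        ∫ x, ⟪u t x, Torus.gradient h x⟫_ℝ * φ t x) S t := by
  have hφs := hφ.smooth_scalar
  have hΦ : Torus.IsSmoothSpaceTimeOn S (fun τ x => h x * φ τ x) :=
    (Torus.isSmoothSpaceTimeOn_const hh _).mul hφs
  have hφt : Torus.IsSmooth (φ t) := hφs.isSmooth_slice ht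
  have hut : Torus.IsSmooth (u t) := hφ.smooth_velocity.isSmooth_slice ht
  have hE := hΦ.hasDerivWithinAt_integral hS ht
  -- pointwise: the time derivative of the integrand
  have hpt : ∀ x, Torus.timeDerivWithin S (fun τ x => h x * φ τ x) t x =
      κ * (h x * Torus.laplacian (φ t) x) - h x * ⟪u t x, Torus.gradient (φ t) x⟫_ℝ := by
    intro x
    have h12 : HasDerivWithinAt (fun τ => h x * φ τ x)
        (h x * Torus.timeDerivWithin S φ t x) S t :=
      (hφs.hasDerivWithinAt_slice ht x).const_mul (h x)
    have hprod : Torus.timeDerivWithin S (fun τ x => h x * φ τ x) t x =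
        h x * Torus.timeDerivWithin S φ t x := by
      rw [Torus.timeDerivWithin, h12.derivWithin (hU t ht)]
    have hdφ : Torus.timeDerivWithin S φ t x =
        κ * Torus.laplacian (φ t) x - ⟪u t x, Torus.gradient (φ t) x⟫_ℝ := by
      have e := hφ.transport t ht x
      linarith
    rw [hprod, hdφ]
    ring
  -- integrate: Green's second identity and the transport identity
  have hval : ∫ x, Torus.timeDerivWithin S (fun τ x => h x * φ τ x) t x =
      κ * (∫ x, Torus.laplacian h x * φ t x) + ∫ x, ⟪u t x, Torus.gradient h x⟫_ℝ * φ t x := by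
    have i1 : Integrable (fun x => h x * Torus.laplacian (φ t) x) volume :=
      (hh.smul' hφt.laplacian).integrable
    have i2 : Integrable (fun x => h x * ⟪u t x, Torus.gradient (φ t) x⟫_ℝ) volume :=
      (hh.smul' (hut.inner hφt.gradient)).integrable
    have hibp := Torus.integral_mul_inner_gradient_add_eq_zero hut (hφ.divFree t ht) hh hφt
    simp_rw [hpt]
    rw [integral_sub (i1.const_mul κ) i2, integral_const_mul,
      Torus.integral_mul_laplacian_comm_holds hh hφt]
    linarith
  rw [hval] at hE
  exact hE

/-! ## Cauchy–Schwarz bounds for the two terms of the derivative -/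

omit [DecidableEq d] in
/-- **The diffusive term.** `∫ (Δh) φ ≥ -‖Δh‖_{L²} ‖φ‖_{L²}` for smooth `h`, `φ` on `T^d`
(Cauchy–Schwarz applied to `-Δh` and `φ`). [folklore] -/
theorem neg_sqrt_mul_sqrt_le_integral_laplacian_mul {h φ : UnitAddTorus d → ℝ}
    (hh : Torus.IsSmooth h) (hφ : Torus.IsSmooth φ) :
    -(√(Torus.scalarL2Sq (Torus.laplacian h)) * √(Torus.scalarL2Sq φ)) ≤
      ∫ x, Torus.laplacian h x * φ x := by
  have hcs : ∫ x, (-Torus.laplacian h x) * φ x ≤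
      √(∫ x, (-Torus.laplacian h x) ^ 2) * √(∫ x, φ x ^ 2) :=
    ScalarAnomalySteadySourceFormal.ColdStartVariance.integral_mul_le_sqrt_mul_sqrt
      (hh.laplacian.neg.memLp 2) (hφ.memLp 2)
  simp only [neg_mul, integral_neg, even_two, Even.neg_pow] at hcs
  rw [Torus.scalarL2Sq, Torus.scalarL2Sq]
  linarith

omit [DecidableEq d] in
/-- **The stirring term.** `∫ ⟪u, ∇h⟫ φ ≥ -‖∇h‖_{L^∞} ‖u‖_{L²} ‖φ‖_{L²}` for smooth `u`, `h`, `φ`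
on `T^d`: pointwise `|⟪u, ∇h⟫ φ| ≤ ‖∇h‖_{L^∞} ‖u‖ |φ|` (`‖∇h(x)‖ ≤ sup ‖∇h‖`, the supremum of a
continuous function on the compact torus), then Cauchy–Schwarz for `‖u‖` and `|φ|`. [folklore] -/
theorem neg_iSup_mul_le_integral_inner_gradient_mul {u : UnitAddTorus d → EuclideanSpace ℝ d}
    {h φ : UnitAddTorus d → ℝ} (hu : Torus.IsSmooth u) (hh : Torus.IsSmooth h)
    (hφ : Torus.IsSmooth φ) :
    -((⨆ x, ‖Torus.gradient h x‖) * (√(∫ x, ‖u x‖ ^ 2) * √(Torus.scalarL2Sq φ))) ≤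
      ∫ x, ⟪u x, Torus.gradient h x⟫_ℝ * φ x := by
  set G := ⨆ x, ‖Torus.gradient h x‖ with hG_def
  have hbdd : BddAbove (range fun x => ‖Torus.gradient h x‖) :=
    (isCompact_range hh.gradient.continuous.norm).bddAbove
  have hGx : ∀ x, ‖Torus.gradient h x‖ ≤ G := fun x => le_ciSup hbdd x
  have hG0 : 0 ≤ G := Real.iSup_nonneg fun x => norm_nonneg _
  -- the pointwise bound
  have hpt : ∀ x, -(⟪u x, Torus.gradient h x⟫_ℝ * φ x) ≤ G * (‖u x‖ * ‖φ x‖) := by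
    intro x
    have h1 : |⟪u x, Torus.gradient h x⟫_ℝ * φ x| ≤ G * (‖u x‖ * ‖φ x‖) := by
      rw [abs_mul]
      calc |⟪u x, Torus.gradient h x⟫_ℝ| * |φ x|
          ≤ (‖u x‖ * ‖Torus.gradient h x‖) * |φ x| :=
            mul_le_mul_of_nonneg_right (abs_real_inner_le_norm _ _) (abs_nonneg _)
        _ ≤ (‖u x‖ * G) * |φ x| :=
            mul_le_mul_of_nonneg_right (mul_le_mul_of_nonneg_left (hGx x) (norm_nonneg _))
              (abs_nonneg _)
        _ = G * (‖u x‖ * ‖φ x‖) := by rw [Real.norm_eq_abs]; ring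
    exact (neg_le_abs _).trans h1
  have i1 : Integrable (fun x => -(⟪u x, Torus.gradient h x⟫_ℝ * φ x)) volume :=
    ((hu.inner hh.gradient).smul' hφ).integrable.neg
  have i2 : Integrable (fun x => G * (‖u x‖ * ‖φ x‖)) volume :=
    (continuous_const.mul (hu.continuous.norm.mul hφ.continuous.norm)).integrable_unitAddTorus
  have hint : -(∫ x, ⟪u x, Torus.gradient h x⟫_ℝ * φ x) ≤ G * ∫ x, ‖u x‖ * ‖φ x‖ := by
    rw [← integral_neg, ← integral_const_mul]
    exact integral_mono i1 i2 hpt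
  have hcs : ∫ x, ‖u x‖ * ‖φ x‖ ≤ √(∫ x, ‖u x‖ ^ 2) * √(∫ x, ‖φ x‖ ^ 2) :=
    ScalarAnomalySteadySourceFormal.ColdStartVariance.integral_mul_le_sqrt_mul_sqrt
      (hu.memLp 2).norm (hφ.memLp 2).norm
  have hφ2 : ∫ x, ‖φ x‖ ^ 2 = Torus.scalarL2Sq φ := by
    simp only [Torus.scalarL2Sq, Real.norm_eq_abs, sq_abs]
  rw [hφ2] at hcs
  linarith [mul_le_mul_of_nonneg_left hcs hG0]

/-! ## The stub: the coherence gate -/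

/-- **F1 `stub_coherenceOfEnergy` (line `Sketch` = duhamel-release, crux
`TwoAndHalfD.TwohalfdThesis`): the kinematic coherence gate.** Let `0 ≤ κ ≤ 1`, `h` smooth on
`T²`, `φ` a classical solution of `∂ₜφ + u·∇φ = κΔφ`, `div u = 0`, on `[s, ∞) × T²` with
`φ(s) = h`, and `∫ ‖u(t)‖² ≤ E` for `t ≥ s`. Then for every `t ≥ s`,
`‖h‖²_{L²} - (‖Δh‖_{L²} + (sup ‖∇h‖) √E) ‖h‖_{L²} (t - s) ≤ ∫ h φ(t)`: a release cannot
decorrelate from its datum faster than the advective time. Proof: the correlation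
`C(t) = ∫ h φ(t)` has `C(s) = ‖h‖²` and derivative `κ ∫ (Δh) φ + ∫ ⟪u, ∇h⟫ φ ≥ -K`
(`hasDerivWithinAt_integral_mul_release`, Cauchy–Schwarz, the `L²` contraction
`‖φ(t)‖ ≤ ‖h‖` and `κ ≤ 1`), so `C(t) + K t` is non-decreasing on `[s, ∞)`
(`monotoneOn_of_hasDerivWithinAt_nonneg`). [folklore] -/
theorem stub_coherenceOfEnergy : ∀ (κ E s : ℝ) (u : ℝ → (UnitAddTorus (Fin 2)) → (EuclideanSpace ℝ (Fin 2))) (h : (UnitAddTorus (Fin 2)) → ℝ) (φ : ℝ → (UnitAddTorus (Fin 2)) → ℝ), 0 ≤ κ → κ ≤ 1 → Torus.IsSmooth h → Torus.IsClassicalScalarTransportOn (Ici s) κ u φ → φ s = h → (∀ t, s ≤ t → ∫ x, ‖u t x‖ ^ 2 ≤ E) → ∀ t, s ≤ t → Torus.scalarL2Sq h - (Real.sqrt (Torus.scalarL2Sq (Torus.laplacian h)) + (⨆ x, ‖Torus.gradient h x‖) * Real.sqrt E) * Real.sqrt (Torus.scalarL2Sq h) * (t - s) ≤ ∫ x, h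 x * φ t x := by
  intro κ E s u h φ hκ0 hκ1 hh hφ hφs hE t hst
  set A := Real.sqrt (Torus.scalarL2Sq (Torus.laplacian h)) with hA_def
  set G := ⨆ x, ‖Torus.gradient h x‖ with hG_def
  set N := Real.sqrt (Torus.scalarL2Sq h) with hN_def
  set K := (A + G * Real.sqrt E) * N with hK_def
  have hA0 : 0 ≤ A := Real.sqrt_nonneg _
  have hG0 : 0 ≤ G := Real.iSup_nonneg fun x => norm_nonneg _
  -- the correlation, its derivative, and the lower bound on the derivative
  have hder : ∀ τ ∈ Ici s, HasDerivWithinAt (fun τ => ∫ x, h x * φ τ x)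
      (κ * (∫ x, Torus.laplacian h x * φ τ x) +
        ∫ x, ⟪u τ x, Torus.gradient h x⟫_ℝ * φ τ x) (Ici s) τ := fun τ hτ =>
    hasDerivWithinAt_integral_mul_release (convex_Ici s) (uniqueDiffOn_Ici s) hh hφ hτ
  have hbound : ∀ τ ∈ Ici s, -K ≤ κ * (∫ x, Torus.laplacian h x * φ τ x) +
      ∫ x, ⟪u τ x, Torus.gradient h x⟫_ℝ * φ τ x := by
    intro τ hτ
    have hsτ : s ≤ τ := mem_Ici.1 hτ
    have hφτ : Torus.IsSmooth (φ τ) := hφ.smooth_scalar.isSmooth_slice hτ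
    have huτ : Torus.IsSmooth (u τ) := hφ.smooth_velocity.isSmooth_slice hτ
    -- the `L²` contraction `‖φ(τ)‖ ≤ ‖φ(s)‖ = ‖h‖`
    have hL2 : Torus.scalarL2Sq (φ τ) ≤ Torus.scalarL2Sq h := by
      have hanti := hφ.antitoneOn_scalarL2Sq hκ0 (Icc_subset_Ici_self : Icc s τ ⊆ Ici s)
      have e := hanti (left_mem_Icc.2 hsτ) (right_mem_Icc.2 hsτ) hsτ
      simpa only [hφs] using e
    have hNτ : √(Torus.scalarL2Sq (φ τ)) ≤ N := Real.sqrt_le_sqrt hL2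
    have hUτ : √(∫ x, ‖u τ x‖ ^ 2) ≤ Real.sqrt E := Real.sqrt_le_sqrt (hE τ hsτ)
    have hsφ : 0 ≤ √(Torus.scalarL2Sq (φ τ)) := Real.sqrt_nonneg _
    have h1 := neg_sqrt_mul_sqrt_le_integral_laplacian_mul hh hφτ
    have h2 := neg_iSup_mul_le_integral_inner_gradient_mul huτ hh hφτ
    -- (a) the diffusive term, `κ ≤ 1`
    have ha : -(A * N) ≤ κ * ∫ x, Torus.laplacian h x * φ τ x := by
      have e : κ * (A * √(Torus.scalarL2Sq (φ τ))) ≤ 1 * (A * N) :=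
        mul_le_mul hκ1 (mul_le_mul_of_nonneg_left hNτ hA0) (mul_nonneg hA0 hsφ) zero_le_one
      nlinarith [mul_le_mul_of_nonneg_left h1 hκ0]
    -- (b) the stirring term, `∫ ‖u(τ)‖² ≤ E`
    have hb : -(G * Real.sqrt E * N) ≤ ∫ x, ⟪u τ x, Torus.gradient h x⟫_ℝ * φ τ x := by
      have e : G * (√(∫ x, ‖u τ x‖ ^ 2) * √(Torus.scalarL2Sq (φ τ))) ≤ G * (Real.sqrt E * N) :=
        mul_le_mul_of_nonneg_left (mul_le_mul hUτ hNτ hsφ (Real.sqrt_nonneg _)) hG0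
      linarith
    rw [hK_def]
    linarith
  -- `τ ↦ C(τ) + K τ` is non-decreasing on `[s, ∞)`
  have hder' : ∀ τ ∈ Ici s, HasDerivWithinAt (fun τ => (∫ x, h x * φ τ x) + K * τ)
      (κ * (∫ x, Torus.laplacian h x * φ τ x) +
        (∫ x, ⟪u τ x, Torus.gradient h x⟫_ℝ * φ τ x) + K) (Ici s) τ := by
    intro τ hτ
    have hlin : HasDerivWithinAt (fun y : ℝ => K * y) K (Ici s) τ := by
      simpa using (hasDerivWithinAt_id τ (Ici s)).const_mul K
    exact (hder τ hτ).add hlin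
  have hmono : MonotoneOn (fun τ => (∫ x, h x * φ τ x) + K * τ) (Ici s) :=
    monotoneOn_of_hasDerivWithinAt_nonneg (convex_Ici s)
      (fun τ hτ => (hder' τ hτ).continuousWithinAt)
      (f' := fun τ => κ * (∫ x, Torus.laplacian h x * φ τ x) +
        (∫ x, ⟪u τ x, Torus.gradient h x⟫_ℝ * φ τ x) + K)
      (fun τ hτ => by
        rw [interior_Ici] at hτ ⊢
        exact (hder' τ (Ioi_subset_Ici_self hτ)).mono Ioi_subset_Ici_self)
      (fun τ hτ => by
        rw [interior_Ici] at hτ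
        have e := hbound τ (Ioi_subset_Ici_self hτ)
        linarith)
  have hst' : (∫ x, h x * φ s x) + K * s ≤ (∫ x, h x * φ t x) + K * t :=
    hmono self_mem_Ici (mem_Ici.2 hst) hst
  have hCs : ∫ x, h x * φ s x = Torus.scalarL2Sq h := by
    simp only [hφs, Torus.scalarL2Sq, sq]
  rw [hCs] at hst'
  linarith

end Summit.AnomalousDissipation.AnomalousDissipation.Theorems.TwohalfdThesis

end
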